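import Literature.Analysis.OperatorTheory.YangMillsMatrixModelColourRotation
import Literature.Analysis.OperatorTheory.YangMillsMatrixModelAgmonDerivatives
import Literature.Analysis.Calculus.SmoothKernelIntegral
import Literature.MathematicalPhysics.QuantumLattice.GaugeGroups
import Mathlib.MeasureTheory.Group.Integral
import Mathlib.Analysis.CStarAlgebra.Matrix
import Mathlib.Analysis.Distribution.AEEqOfIntegralContDiff
import HarnessLib

/-!
# `SO(3)`-averaging for Lüscher's matrix model: invariant weak eigenfunctions are weak eigenfunctions

Topic `Literature/Analysis/OperatorTheory`; step N3 (symmetry) — and, with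
`YangMillsMatrixModelWeakSolutions.lean`, step N4 (regularity) — of the eigenfunction theorem AL1
(`LuscherHamiltonianEigenfunctions`, `YangMillsMatrixModelEigenfunctions.lean`) for Lüscher's effective
Hamiltonian `𝔥 = −½Δ + V` on `ℝ⁹`, whose physical levels `physLevel` are the min–max values on the
`SO(3)`-INVARIANT core.  The variational construction (RS-IV XIII.1–2 on the invariant form core) produces
`L²` vectors `u` that are limits of invariant `C²_c` functions and satisfy the weak eigen-equation
`∫ u·𝔥g = E ∫ u·g` only for INVARIANT test functions `g`; interior regularity needs it for ALL `φ ∈ C^∞_c`.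
The bridge is the classical averaging device over the compact symmetry group (Bröcker–tom Dieck I §5:
«integration is used to average functions over `G`, thereby making them invariant»):

* `rotAvg φ (x) := ∫_{SO(3)} φ(k⁻¹·x) dk` (normalised Haar measure `haarProbability`, the tree's idiom of
  `QuantumLattice/GaugeGroups.lean`; no new instance): for `φ ∈ C^∞_c` it is `C^∞` (`contDiff_rotAvg`, by
  the tree's differentiation-under-the-integral theorem `contDiff_integral_kernel_mul`), compactly
  supported, and `SO(3)`-invariant (`isGaugeInv_rotAvg`, left invariance of `dk`, BtD I (5.12));
* `integral_mul_rotAvg` — the Fubini/change-of-variables pairing `∫ u·rotAvg g = ∫_k ∫ u(k·y) g(y) dy dk`,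
  hence `∫ u·rotAvg g = ∫ u·g` for an a.e.-invariant weight `u` (`integral_mul_rotAvg_of_aeInv`);
* ★ `hApply_rotAvg` — `𝔥(rotAvg φ) = rotAvg(𝔥φ)` (the Hamiltonian commutes with the averaging; proved
  weakly from `hApply_comp_colourRotate` and Green's identity, then pointwise by continuity and the
  du Bois-Reymond lemma, Lieb–Loss Thm. 6.5);
* ★ `weak_allTests_of_weak_invTests` — an a.e.-`SO(3)`-invariant locally integrable `w` satisfying the weak
  eigen-equation against invariant `C²_c` tests satisfies it against every `φ ∈ C^∞_c`;
* `aeInv_of_mem_closure_core` — `L²`-limits of invariant core functions are a.e.-invariant;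
* ★ `exists_smooth_gaugeInv_classical_of_weak`, `smooth_gaugeInv_eigenseq_of_weak` — N3 + N4 assembled:
  a weak invariant eigenvector (resp. an orthonormal sequence of them, as produced by the variational
  principle) is a.e. equal to a smooth, `SO(3)`-invariant, classical solution of `𝔥f = Ef` in `L²`
  (resp. an `L²`-orthonormal family of such), ready for the Agmon decay step N5.

Definitions with bodies (`SO3`, `invEntries`, `rotAvg`); theorems proved; no named facts, no instances.

## References
* [BrockerTomDieck1985] T. Bröcker, T. tom Dieck, *Representations of Compact Lie Groups*, Ch. I §5,
  Thm. (5.12)–(5.13) (invariance and uniqueness of the normalised integral, PDF p. 48) and the remark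
  opening the applications (averaging makes functions invariant, PDF p. 50).
* [LiebLoss2001] E. H. Lieb, M. Loss, *Analysis*, 2nd ed., Thm. 6.5 (functions are determined by their
  distributions, PDF p. 117), §7.7/Thm. 11.7–11.9 (weak eigen-equations of Schrödinger forms).
* [ReedSimonIV1978] M. Reed, B. Simon, *Methods of Modern Mathematical Physics IV*, §XIII.1–2 (min–max on a
  form core), §XIII.12 (symmetry-reduced operators).
-/

noncomputable section

open MeasureTheory Filter Matrix Set Function
open scoped BigOperators RealInnerProductSpace ContDiff Topology
open Literature.MathematicalPhysics.QuantumFieldTheory (haarProbability)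

namespace Literature.Analysis.OperatorTheory.YMMatrixModel

/-! ### 1. The group `SO(3)` of colour rotations and its Haar probability measure -/

/-- The residual gauge group `SO(3)` of the zero-mode problem, as a type (a compact topological group
with its Borel σ-algebra — instances of `QuantumLattice/GaugeGroups.lean` for `specialUnitaryGroup n ℝ`).
[cite: BrockerTomDieck1985, Ch. I §5 (5.12)] -/
abbrev SO3 : Type := ↥(Matrix.specialOrthogonalGroup (Fin 3) ℝ)

/-- An element of `SO(3)` is an orthogonal matrix. [cite: BrockerTomDieck1985, Ch. I §1] -/
theorem SO3.mem_orthogonalGroup (k : SO3) :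
    (k : Matrix (Fin 3) (Fin 3) ℝ) ∈ Matrix.orthogonalGroup (Fin 3) ℝ := k.2.1

/-- In `SO(3)` the inverse is the transpose. [cite: BrockerTomDieck1985, Ch. I §1] -/
theorem SO3.coe_inv (k : SO3) :
    ((k⁻¹ : SO3) : Matrix (Fin 3) (Fin 3) ℝ) = (k : Matrix (Fin 3) (Fin 3) ℝ)ᵀ := by
  rw [← Matrix.star_eq_inv, Matrix.specialUnitaryGroup.coe_star, Matrix.star_eq_conjTranspose,
    Matrix.conjTranspose_eq_transpose_of_trivial]

/-- `k·(k⁻¹·x) = x`. [cite: BrockerTomDieck1985, Ch. I §1] -/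
@[simp] theorem colourRotate_coe_colourRotate_coe_inv (k : SO3) (x : ZM) :
    colourRotate (k : Matrix (Fin 3) (Fin 3) ℝ) (colourRotate ((k⁻¹ : SO3) : Matrix (Fin 3) (Fin 3) ℝ) x)
      = x := by
  rw [SO3.coe_inv]; exact colourRotate_colourRotate_transpose k.2.1 x

/-- `k⁻¹·(k·x) = x`. [cite: BrockerTomDieck1985, Ch. I §1] -/
@[simp] theorem colourRotate_coe_inv_colourRotate_coe (k : SO3) (x : ZM) :
    colourRotate ((k⁻¹ : SO3) : Matrix (Fin 3) (Fin 3) ℝ) (colourRotate (k : Matrix (Fin 3) (Fin 3) ℝ) x)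
      = x := by
  rw [SO3.coe_inv]; exact colourRotate_transpose_colourRotate k.2.1 x

/-- `MeasurableEmbedding` of an orthogonal colour rotation (it is a homeomorphism).
[cite: BrockerTomDieck1985, Ch. I §5 (5.12)] -/
theorem measurableEmbedding_colourRotate {M : Matrix (Fin 3) (Fin 3) ℝ}
    (hM : M ∈ Matrix.orthogonalGroup (Fin 3) ℝ) : MeasurableEmbedding (colourRotate M) :=
  (colourRotateLIE hM).toHomeomorph.measurableEmbedding

/-- The entries of `k⁻¹` as a point of the normed space `ℝ^{3×3}` (the parameter of the averaging kernel).
[cite: BrockerTomDieck1985, Ch. I §5 (5.12)] -/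
def invEntries (k : SO3) : Fin 3 → Fin 3 → ℝ := fun a b => ((k⁻¹ : SO3) : Matrix (Fin 3) (Fin 3) ℝ) a b

/-- `k ↦ k⁻¹` (as a point of `ℝ^{3×3}`) is continuous. [cite: BrockerTomDieck1985, Ch. I §1] -/
theorem continuous_invEntries : Continuous invEntries :=
  continuous_pi fun a => continuous_pi fun b =>
    ((continuous_subtype_val.comp continuous_inv).matrix_elem a b)

/-- The entries of an orthogonal matrix are bounded by `1`. [cite: BrockerTomDieck1985, Ch. I §1] -/
theorem norm_invEntries_le (k : SO3) : ‖invEntries k‖ ≤ 1 := by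
  refine (pi_norm_le_iff_of_nonneg zero_le_one).2 fun a =>
    (pi_norm_le_iff_of_nonneg zero_le_one).2 fun b => ?_
  exact entry_norm_bound_of_unitary (k⁻¹).2.1 a b

/-- The colour action `(x, M) ↦ M·x` is jointly smooth (bilinear). [cite: Vanbaal2001, §4] -/
theorem contDiff_colourRotate_uncurry :
    ContDiff ℝ ∞ fun q : ZM × (Fin 3 → Fin 3 → ℝ) => colourRotate (Matrix.of q.2) q.1 := by
  refine contDiff_euclidean.2 fun p => ?_
  simp only [colourRotate_apply, Matrix.of_apply]
  exact ContDiff.sum fun b _ =>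
    ((contDiff_apply_apply ℝ ℝ (n := ∞) p.2 b).comp contDiff_snd).mul
      ((contDiff_coordZM (p.1, b)).comp contDiff_fst)

/-- Joint continuity of `(x, k) ↦ g(k⁻¹·x)` for continuous `g`. [cite: BrockerTomDieck1985, Ch. I §5 (5.12)] -/
theorem continuous_comp_colourRotate_inv {g : ZM → ℝ} (hg : Continuous g) :
    Continuous fun z : ZM × SO3 => g (colourRotate ((z.2⁻¹ : SO3) : Matrix (Fin 3) (Fin 3) ℝ) z.1) :=
  hg.comp (contDiff_colourRotate_uncurry.continuous.comp
    (continuous_fst.prodMk (continuous_invEntries.comp continuous_snd)))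

/-! ### 2. The rotation average -/

/-- **The `SO(3)`-average** `(rotAvg φ)(x) = ∫_{SO(3)} φ(k⁻¹·x) dk` of a function on `ℝ⁹` over the colour
rotations, `dk` the normalised Haar measure. [cite: BrockerTomDieck1985, Ch. I §5 (5.12)–(5.13), PDF p. 50] -/
def rotAvg (φ : ZM → ℝ) (x : ZM) : ℝ :=
  ∫ k : SO3, φ (colourRotate ((k⁻¹ : SO3) : Matrix (Fin 3) (Fin 3) ℝ) x) ∂(haarProbability SO3)

/-- Unfolding `rotAvg`. [cite: BrockerTomDieck1985, Ch. I §5 (5.12)] -/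
theorem rotAvg_def (φ : ZM → ℝ) (x : ZM) : rotAvg φ x =
    ∫ k : SO3, φ (colourRotate ((k⁻¹ : SO3) : Matrix (Fin 3) (Fin 3) ℝ) x) ∂(haarProbability SO3) := rfl

variable {φ : ZM → ℝ}

/-- ★ **Smoothness of the average**: `rotAvg φ ∈ C^∞` for `φ ∈ C^∞` (differentiation under the integral
sign over the compact parameter space `SO(3)`). [cite: BrockerTomDieck1985, Ch. I §5, PDF p. 50] -/
theorem contDiff_rotAvg (hφ : ContDiff ℝ ∞ φ) : ContDiff ℝ ∞ (rotAvg φ) := by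
  have hA : ContDiff ℝ ∞ fun q : ZM × (Fin 3 → Fin 3 → ℝ) =>
      ((φ (colourRotate (Matrix.of q.2) q.1) : ℝ) : ℂ) :=
    Complex.ofRealCLM.contDiff.comp (hφ.comp contDiff_colourRotate_uncurry)
  have h := Literature.Analysis.Calculus.contDiff_integral_kernel_mul (ν := haarProbability SO3) hA
    continuous_invEntries.aestronglyMeasurable (R := 1) (Eventually.of_forall norm_invEntries_le)
    (F := fun _ => (1 : ℂ)) (integrable_const _)
  have e : rotAvg φ = fun X => Complex.reCLM
      (∫ k : SO3, (fun q : ZM × (Fin 3 → Fin 3 → ℝ) => ((φ (colourRotate (Matrix.of q.2) q.1) : ℝ) : ℂ))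
        (X, invEntries k) * (fun _ : SO3 => (1 : ℂ)) k ∂(haarProbability SO3)) := by
    funext X
    simp only [Complex.reCLM_apply, mul_one]
    rw [integral_complex_ofReal, Complex.ofReal_re]
    rfl
  rw [e]
  exact Complex.reCLM.contDiff.comp h

/-- `rotAvg φ ∈ C^n` for every `n` when `φ ∈ C^∞`. [cite: BrockerTomDieck1985, Ch. I §5, PDF p. 50] -/
theorem contDiff_rotAvg_of_le (hφ : ContDiff ℝ ∞ φ) (n : ℕ∞) : ContDiff ℝ n (rotAvg φ) :=
  (contDiff_rotAvg hφ).of_le (WithTop.coe_le_coe.2 le_top)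

/-- ★ **The average is `SO(3)`-invariant** (left invariance of Haar measure: `∫ f(hk) dk = ∫ f(k) dk`).
[cite: BrockerTomDieck1985, Ch. I Thm. (5.12), PDF p. 48] -/
theorem isGaugeInv_rotAvg (φ : ZM → ℝ) : IsGaugeInv (rotAvg φ) := by
  intro R hR x
  haveI : (haarProbability SO3).IsMulLeftInvariant := by
    unfold haarProbability; infer_instance
  set R' : SO3 := ⟨R, hR⟩
  have hk : ∀ k : SO3, colourRotate ((k⁻¹ : SO3) : Matrix (Fin 3) (Fin 3) ℝ) (colourRotate R x)
      = colourRotate (((R'⁻¹ * k)⁻¹ : SO3) : Matrix (Fin 3) (Fin 3) ℝ) x := by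
    intro k
    rw [colourRotate_mul, _root_.mul_inv_rev, inv_inv, Submonoid.coe_mul]
  rw [rotAvg_def, rotAvg_def]
  simp_rw [hk]
  exact integral_mul_left_eq_self
    (fun k : SO3 => φ (colourRotate ((k⁻¹ : SO3) : Matrix (Fin 3) (Fin 3) ℝ) x)) R'⁻¹

/-- Outside a ball containing the support of `φ` the average vanishes (rotations are isometries).
[cite: BrockerTomDieck1985, Ch. I §5, PDF p. 50] -/
theorem rotAvg_eq_zero_of_lt_norm {R : ℝ} (hR : tsupport φ ⊆ Metric.closedBall 0 R) {x : ZM}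
    (hx : R < ‖x‖) : rotAvg φ x = 0 := by
  have : ∀ k : SO3, φ (colourRotate ((k⁻¹ : SO3) : Matrix (Fin 3) (Fin 3) ℝ) x) = 0 := fun k => by
    apply image_eq_zero_of_notMem_tsupport
    intro hmem
    have h1 := hR hmem
    rw [Metric.mem_closedBall, dist_zero_right,
      norm_colourRotate_of_mem_orthogonalGroup (k⁻¹).2.1] at h1
    exact (not_le.mpr hx) h1
  simp [rotAvg_def, this]

/-- The average of a compactly supported function is compactly supported.
[cite: BrockerTomDieck1985, Ch. I §5, PDF p. 50] -/
theorem hasCompactSupport_rotAvg (hφ : HasCompactSupport φ) : HasCompactSupport (rotAvg φ) := by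
  obtain ⟨R, hR⟩ := hφ.isCompact.isBounded.subset_closedBall 0
  refine HasCompactSupport.intro (isCompact_closedBall (0 : ZM) R) fun x hx => ?_
  exact rotAvg_eq_zero_of_lt_norm hR
    (by simpa [Metric.mem_closedBall, dist_zero_right, not_le] using hx)

/-- The average of a `C^∞_c` function is an (invariant) core function. [cite: BrockerTomDieck1985, Ch. I §5, PDF p. 50] -/
theorem isTestFn_rotAvg (hφ : ContDiff ℝ ∞ φ) (hφs : HasCompactSupport φ) : IsTestFn (rotAvg φ) :=
  ⟨contDiff_rotAvg_of_le hφ 2, hasCompactSupport_rotAvg hφs⟩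

/-! ### 3. Pairing with a weight: Fubini and change of variables -/

/-- Integrability of `(x, k) ↦ u(x) g(k⁻¹·x)` on `ℝ⁹ × SO(3)` for `u ∈ L¹_loc`, `g ∈ C_c`
(dominated by `‖g‖_∞ · |u| · 1_{B_R}`). [cite: BrockerTomDieck1985, Ch. I Prop. (5.16) «Fubini», PDF p. 51] -/
theorem integrable_mul_comp_colourRotate_inv_prod {u g : ZM → ℝ} (hu : LocallyIntegrable u volume)
    (hg : Continuous g) (hgs : HasCompactSupport g) :
    Integrable (fun z : ZM × SO3 => u z.1 * g (colourRotate ((z.2⁻¹ : SO3) : Matrix (Fin 3) (Fin 3) ℝ) z.1))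
      ((volume : Measure ZM).prod (haarProbability SO3)) := by
  obtain ⟨R, hR⟩ := hgs.isCompact.isBounded.subset_closedBall 0
  obtain ⟨C, hC⟩ := hg.bounded_above_of_compact_support hgs
  have hC0 : 0 ≤ C := (norm_nonneg _).trans (hC 0)
  set K : Set ZM := Metric.closedBall 0 R with hK
  have hKi : Integrable (K.indicator u) volume :=
    (hu.integrableOn_isCompact (isCompact_closedBall 0 R)).integrable_indicator
      Metric.isClosed_closedBall.measurableSet
  have hdom : Integrable (fun z : ZM × SO3 => ‖K.indicator u z.1‖ * C)
      ((volume : Measure ZM).prod (haarProbability SO3)) :=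
    hKi.norm.mul_prod (integrable_const C)
  refine hdom.mono' (hu.aestronglyMeasurable.comp_fst.mul
    (continuous_comp_colourRotate_inv hg).aestronglyMeasurable) (Eventually.of_forall fun z => ?_)
  rw [norm_mul]
  by_cases hz : z.1 ∈ K
  · rw [indicator_of_mem hz]
    exact mul_le_mul_of_nonneg_left (hC _) (norm_nonneg _)
  · have h0 : g (colourRotate ((z.2⁻¹ : SO3) : Matrix (Fin 3) (Fin 3) ℝ) z.1) = 0 := by
      apply image_eq_zero_of_notMem_tsupport
      intro hmem
      apply hz
      have h1 := hR hmem
      rwa [Metric.mem_closedBall, dist_zero_right,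
        norm_colourRotate_of_mem_orthogonalGroup (z.2⁻¹).2.1, ← dist_zero_right,
        ← Metric.mem_closedBall] at h1
    rw [h0, norm_zero, mul_zero]
    exact mul_nonneg (norm_nonneg _) hC0

/-- ★ **Pairing formula** `∫ u(x)·(rotAvg g)(x) dx = ∫_{SO(3)} ∫ u(k·y) g(y) dy dk` for `u ∈ L¹_loc`,
`g ∈ C_c` (Fubini, then the measure-preserving substitution `x = k·y`).
[cite: BrockerTomDieck1985, Ch. I Thm. (5.12) and Prop. (5.16), PDF pp. 48–51] -/
theorem integral_mul_rotAvg {u g : ZM → ℝ} (hu : LocallyIntegrable u volume) (hg : Continuous g)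
    (hgs : HasCompactSupport g) :
    ∫ x, u x * rotAvg g x =
      ∫ k : SO3, ∫ y, u (colourRotate (k : Matrix (Fin 3) (Fin 3) ℝ) y) * g y ∂volume
        ∂(haarProbability SO3) := by
  have h1 : ∀ x, u x * rotAvg g x = ∫ k : SO3,
      u x * g (colourRotate ((k⁻¹ : SO3) : Matrix (Fin 3) (Fin 3) ℝ) x) ∂(haarProbability SO3) :=
    fun x => by rw [rotAvg_def, integral_const_mul]
  simp_rw [h1]
  rw [integral_integral_swap (integrable_mul_comp_colourRotate_inv_prod hu hg hgs)]
  refine integral_congr_ae (Eventually.of_forall fun k => ?_)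
  have hk := SO3.mem_orthogonalGroup k
  show ∫ x, u x * g (colourRotate ((k⁻¹ : SO3) : Matrix (Fin 3) (Fin 3) ℝ) x) ∂volume
    = ∫ y, u (colourRotate (k : Matrix (Fin 3) (Fin 3) ℝ) y) * g y ∂volume
  rw [← (measurePreserving_colourRotate hk).integral_comp (measurableEmbedding_colourRotate hk)
    (fun x => u x * g (colourRotate ((k⁻¹ : SO3) : Matrix (Fin 3) (Fin 3) ℝ) x))]
  simp_rw [colourRotate_coe_inv_colourRotate_coe]

/-- ★ **Invariant weights do not see the averaging**: if `u ∈ L¹_loc` is a.e.-invariant under every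
colour rotation of `SO(3)`, then `∫ u·rotAvg g = ∫ u·g` for `g ∈ C_c` (each fibre integral of the pairing
formula equals `∫ u g`, and `dk` is a probability measure). [cite: BrockerTomDieck1985, Ch. I Thm. (5.12)–(5.13), PDF p. 48] -/
theorem integral_mul_rotAvg_of_aeInv {u g : ZM → ℝ} (hu : LocallyIntegrable u volume)
    (hinv : ∀ R : Matrix (Fin 3) (Fin 3) ℝ, R ∈ Matrix.specialOrthogonalGroup (Fin 3) ℝ →
      (fun x => u (colourRotate R x)) =ᵐ[volume] u)
    (hg : Continuous g) (hgs : HasCompactSupport g) :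
    ∫ x, u x * rotAvg g x = ∫ x, u x * g x := by
  rw [integral_mul_rotAvg hu hg hgs]
  have : ∀ k : SO3, ∫ y, u (colourRotate (k : Matrix (Fin 3) (Fin 3) ℝ) y) * g y = ∫ y, u y * g y :=
    fun k => integral_congr_ae ((hinv k.1 k.2).mul EventuallyEq.rfl)
  simp_rw [this]
  simp

/-! ### 4. The Hamiltonian commutes with the averaging -/

/-- `𝔥φ ∈ C^∞` for `φ ∈ C^∞` (the potential is a polynomial). [cite: LiebLoss2001, Thm. 11.7] -/
theorem contDiff_hApply_of_infty (hφ : ContDiff ℝ ∞ φ) : ContDiff ℝ ∞ (hApply φ) := by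
  have hlap : ContDiff ℝ ∞ (laplacian φ) := by
    unfold laplacian
    exact ContDiff.sum fun p _ => contDiff_pderiv_of_infty (contDiff_pderiv_of_infty hφ p) p
  unfold hApply
  exact (contDiff_const.mul hlap).add (contDiff_luscherPotential.mul hφ)

/-- ★ **`𝔥(rotAvg φ) = rotAvg(𝔥φ)` for `φ ∈ C^∞_c`.**  Weakly this is `𝔥(φ∘k) = (𝔥φ)∘k`
(`hApply_comp_colourRotate`) integrated over `k` with Green's identity moving `𝔥` onto the test
function; both sides being continuous, the identity holds pointwise (Lieb–Loss Thm. 6.5).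
[cite: LiebLoss2001, Thm. 6.5, PDF p. 117] [cite: BrockerTomDieck1985, Ch. I Thm. (5.12)] -/
theorem hApply_rotAvg (hφ : ContDiff ℝ ∞ φ) (hφs : HasCompactSupport φ) (x : ZM) :
    hApply (rotAvg φ) x = rotAvg (hApply φ) x := by
  have hrot : ContDiff ℝ ∞ (rotAvg φ) := contDiff_rotAvg hφ
  have hHφ : ContDiff ℝ ∞ (hApply φ) := contDiff_hApply_of_infty hφ
  have hφt : IsTestFn φ := ⟨contDiff_infty.1 hφ 2, hφs⟩
  have hHφs : HasCompactSupport (hApply φ) := hasCompactSupport_hApply hφt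
  have hL : Continuous (hApply (rotAvg φ)) := continuous_hApply (contDiff_infty.1 hrot 2)
  have hR : Continuous (rotAvg (hApply φ)) := (contDiff_rotAvg hHφ).continuous
  suffices h : (fun x => hApply (rotAvg φ) x - rotAvg (hApply φ) x) = fun _ => 0 by
    have := congrFun h x
    simpa [sub_eq_zero] using this
  refine ((hL.sub hR).ae_eq_iff_eq volume continuous_const).1 ?_
  refine ae_eq_zero_of_integral_contDiff_smul_eq_zero (hL.sub hR).locallyIntegrable fun ψ hψ hψs => ?_
  have hψt : IsTestFn ψ := ⟨contDiff_infty.1 hψ 2, hψs⟩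
  have hiL : Integrable (fun x => ψ x * hApply (rotAvg φ) x) :=
    (hψ.continuous.mul hL).integrable_of_hasCompactSupport hψs.mul_right
  have hiR : Integrable (fun x => ψ x * rotAvg (hApply φ) x) :=
    (hψ.continuous.mul hR).integrable_of_hasCompactSupport hψs.mul_right
  simp only [smul_eq_mul, Pi.sub_apply, mul_sub]
  rw [integral_sub hiL hiR, sub_eq_zero]
  calc ∫ x, ψ x * hApply (rotAvg φ) x
      = ∫ x, hApply ψ x * rotAvg φ x := by
        simp_rw [mul_comm (ψ _) (hApply (rotAvg φ) _)]
        rw [integral_hApply_mul_eq_integral_mul_hApply (contDiff_infty.1 hrot 2) hψt]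
        simp_rw [mul_comm (rotAvg φ _) (hApply ψ _)]
    _ = ∫ k : SO3, ∫ y, hApply ψ (colourRotate (k : Matrix (Fin 3) (Fin 3) ℝ) y) * φ y ∂volume
          ∂(haarProbability SO3) :=
        integral_mul_rotAvg (continuous_hApply hψt.1).locallyIntegrable hφ.continuous hφs
    _ = ∫ k : SO3, ∫ y, ψ (colourRotate (k : Matrix (Fin 3) (Fin 3) ℝ) y) * hApply φ y ∂volume
          ∂(haarProbability SO3) := by
        refine integral_congr_ae (Eventually.of_forall fun k => ?_)
        have hk := SO3.mem_orthogonalGroup k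
        have hψk : ContDiff ℝ 2 fun y => ψ (colourRotate (k : Matrix (Fin 3) (Fin 3) ℝ) y) :=
          contDiff_comp_colourRotate hψt.1 _
        show ∫ y, hApply ψ (colourRotate (k : Matrix (Fin 3) (Fin 3) ℝ) y) * φ y ∂volume
          = ∫ y, ψ (colourRotate (k : Matrix (Fin 3) (Fin 3) ℝ) y) * hApply φ y ∂volume
        simp_rw [← hApply_comp_colourRotate hk hψt.1]
        exact integral_hApply_mul_eq_integral_mul_hApply hψk hφt
    _ = ∫ x, ψ x * rotAvg (hApply φ) x :=
        (integral_mul_rotAvg hψ.continuous.locallyIntegrable hHφ.continuous hHφs).symm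

/-! ### 5. From invariant test functions to all test functions -/

/-- ★ **N3 (symmetry).**  Let `w ∈ L¹_loc(ℝ⁹)` be a.e.-invariant under every colour rotation of `SO(3)` and
satisfy the weak eigen-equation `∫ w·𝔥g = E ∫ w·g` for all INVARIANT core functions `g ∈ C²_c`.  Then
`∫ w·𝔥φ = E ∫ w·φ` for EVERY `φ ∈ C^∞_c`: test with the invariant average `rotAvg φ`, commute `𝔥` past the
average (`hApply_rotAvg`) and remove the average against the invariant weight (`integral_mul_rotAvg_of_aeInv`).
[cite: BrockerTomDieck1985, Ch. I §5 (5.12)–(5.13), PDF pp. 48–50] [cite: ReedSimonIV1978, §XIII.12] -/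
theorem weak_allTests_of_weak_invTests {w : ZM → ℝ} {E : ℝ} (hw : LocallyIntegrable w volume)
    (hinv : ∀ R : Matrix (Fin 3) (Fin 3) ℝ, R ∈ Matrix.specialOrthogonalGroup (Fin 3) ℝ →
      (fun x => w (colourRotate R x)) =ᵐ[volume] w)
    (hweak : ∀ g : ZM → ℝ, IsTestFn g → IsGaugeInv g →
      ∫ x, w x * hApply g x = E * ∫ x, w x * g x)
    (hφ : ContDiff ℝ ∞ φ) (hφs : HasCompactSupport φ) :
    ∫ x, w x * hApply φ x = E * ∫ x, w x * φ x := by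
  have hφt : IsTestFn φ := ⟨contDiff_infty.1 hφ 2, hφs⟩
  have hHφ : ContDiff ℝ ∞ (hApply φ) := contDiff_hApply_of_infty hφ
  have hHφs : HasCompactSupport (hApply φ) := hasCompactSupport_hApply hφt
  calc ∫ x, w x * hApply φ x = ∫ x, w x * rotAvg (hApply φ) x :=
        (integral_mul_rotAvg_of_aeInv hw hinv hHφ.continuous hHφs).symm
    _ = ∫ x, w x * hApply (rotAvg φ) x := by simp_rw [hApply_rotAvg hφ hφs]
    _ = E * ∫ x, w x * rotAvg φ x := hweak _ (isTestFn_rotAvg hφ hφs) (isGaugeInv_rotAvg φ)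
    _ = E * ∫ x, w x * φ x := by rw [integral_mul_rotAvg_of_aeInv hw hinv hφ.continuous hφs]

/-- **`L²`-limits of invariant core functions are a.e.-invariant**: for every `R ∈ SO(3)` the set of
`v ∈ L²` with `v∘R· = v` is closed (composition with the measure-preserving `R·` is an isometry of `L²`)
and contains every `v` a.e. equal to an invariant core function. [cite: ReedSimonIV1978, §XIII.12] -/
theorem aeInv_of_mem_closure_core {v : Lp ℝ 2 (volume : Measure ZM)}
    (hv : v ∈ closure {v : Lp ℝ 2 (volume : Measure ZM) |
      ∃ ψ : ZM → ℝ, IsTestFn ψ ∧ IsGaugeInv ψ ∧ (v : ZM → ℝ) =ᵐ[volume] ψ})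
    {R : Matrix (Fin 3) (Fin 3) ℝ} (hR : R ∈ Matrix.specialOrthogonalGroup (Fin 3) ℝ) :
    (fun x => v (colourRotate R x)) =ᵐ[volume] (v : ZM → ℝ) := by
  have hmp := measurePreserving_colourRotate hR.1
  set T : Lp ℝ 2 (volume : Measure ZM) → Lp ℝ 2 (volume : Measure ZM) :=
    fun w => Lp.compMeasurePreserving (colourRotate R) hmp w with hT_def
  have hT : Continuous T := (Lp.isometry_compMeasurePreserving (E := ℝ) (p := 2) hmp).continuous
  have hTw : ∀ w : Lp ℝ 2 (volume : Measure ZM),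
      (T w : ZM → ℝ) =ᵐ[volume] fun x => w (colourRotate R x) :=
    fun w => Lp.coeFn_compMeasurePreserving w hmp
  have hclosed : IsClosed {w : Lp ℝ 2 (volume : Measure ZM) | T w = w} :=
    isClosed_eq hT continuous_id
  have hsub : {v : Lp ℝ 2 (volume : Measure ZM) |
      ∃ ψ : ZM → ℝ, IsTestFn ψ ∧ IsGaugeInv ψ ∧ (v : ZM → ℝ) =ᵐ[volume] ψ} ⊆ {w | T w = w} := by
    rintro w ⟨ψ, -, hψi, hw⟩
    show T w = w
    apply Lp.ext
    have h2 : (fun x => w (colourRotate R x)) =ᵐ[volume] fun x => ψ (colourRotate R x) :=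
      ae_eq_comp' hmp.measurable.aemeasurable hw hmp.map_eq.absolutelyContinuous
    refine (hTw w).trans (h2.trans ?_)
    rw [hψi.comp_colourRotate_eq hR]
    exact hw.symm
  have hvT : T v = v := closure_minimal hsub hclosed hv
  have h1 := hTw v
  rw [hvT] at h1
  exact h1.symm

/-! ### 6. N3 + N4: smooth invariant classical eigenfunctions from weak invariant ones -/

/-- ★ **N3 + N4.**  A vector `v ∈ L²(ℝ⁹)` in the closure of the invariant core which satisfies the weak
eigen-equation `∫ v·𝔥g = E ∫ v·g` against the invariant core functions is a.e. equal to a smooth,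
`SO(3)`-invariant function `f ∈ L²` solving `𝔥f = Ef` classically (`weak_allTests_of_weak_invTests` +
the interior-regularity theorem `exists_smooth_classical_of_weak`; pointwise invariance of the continuous
representative from its a.e. invariance). [cite: LiebLoss2001, Thm. 11.7–11.9 with Thm. 6.5] [cite: ReedSimonIV1978, §XIII.12] -/
theorem exists_smooth_gaugeInv_classical_of_weak {v : Lp ℝ 2 (volume : Measure ZM)} {E : ℝ}
    (hv : v ∈ closure {v : Lp ℝ 2 (volume : Measure ZM) |
      ∃ ψ : ZM → ℝ, IsTestFn ψ ∧ IsGaugeInv ψ ∧ (v : ZM → ℝ) =ᵐ[volume] ψ})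
    (hweak : ∀ g : ZM → ℝ, IsTestFn g → IsGaugeInv g →
      ∫ x, v x * hApply g x = E * ∫ x, v x * g x) :
    ∃ f : ZM → ℝ, (∀ n : ℕ∞, ContDiff ℝ n f) ∧ IsGaugeInv f ∧ (v : ZM → ℝ) =ᵐ[volume] f ∧
      (∀ x, hApply f x = E * f x) ∧ MemLp f 2 volume := by
  have hv2 : MemLp (v : ZM → ℝ) 2 volume := Lp.memLp v
  have hli : LocallyIntegrable (v : ZM → ℝ) volume := locallyIntegrable_of_memLp_two hv2
  have hinv : ∀ R : Matrix (Fin 3) (Fin 3) ℝ, R ∈ Matrix.specialOrthogonalGroup (Fin 3) ℝ →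
      (fun x => v (colourRotate R x)) =ᵐ[volume] (v : ZM → ℝ) :=
    fun R hR => aeInv_of_mem_closure_core hv hR
  have hall : ∀ φ : ZM → ℝ, ContDiff ℝ ∞ φ → HasCompactSupport φ →
      ∫ x, v x * hApply φ x = E * ∫ x, v x * φ x :=
    fun φ hφ hφs => weak_allTests_of_weak_invTests hli hinv hweak hφ hφs
  obtain ⟨f, hf, hvf, hfE⟩ := exists_smooth_classical_of_weak hli hall
  have hfc : Continuous f := (hf 0).continuous
  refine ⟨f, hf, ?_, hvf, hfE, hv2.ae_eq hvf⟩
  intro R hR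
  have hmp := measurePreserving_colourRotate hR.1
  have h1 : (fun x => f (colourRotate R x)) =ᵐ[volume] fun x => v (colourRotate R x) :=
    ae_eq_comp' hmp.measurable.aemeasurable hvf.symm hmp.map_eq.absolutelyContinuous
  have h2 : (fun x => f (colourRotate R x)) =ᵐ[volume] f := h1.trans ((hinv R hR).trans hvf)
  have h3 : (fun x => f (colourRotate R x)) = f :=
    ((hfc.comp (continuous_colourRotate R)).ae_eq_iff_eq volume hfc).1 h2
  exact fun x => congrFun h3 x

/-- ★ **N1–N4 modulo the variational input**: an `L²`-ORTHONORMAL SEQUENCE `u_k` of weak invariant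
eigenvectors with eigenvalues `physLevel (k+1)` (as delivered by the min–max principle on the invariant
form core with compact resolvent, RS-IV XIII.1–2/XIII.64) is realised by smooth, `SO(3)`-invariant,
`L²`-orthonormal classical eigenfunctions `𝔥 f_k = physLevel(k+1) f_k` — the input of the Agmon decay
step N5 of `LuscherHamiltonianEigenfunctions`. [cite: ReedSimonIV1978, §XIII.1–2, §XIII.12] [cite: LiebLoss2001, Thm. 11.7–11.9] -/
theorem smooth_gaugeInv_eigenseq_of_weak (u : ℕ → Lp ℝ 2 (volume : Measure ZM))
    (hon : Orthonormal ℝ u)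
    (hcl : ∀ k, u k ∈ closure {v : Lp ℝ 2 (volume : Measure ZM) |
      ∃ ψ : ZM → ℝ, IsTestFn ψ ∧ IsGaugeInv ψ ∧ (v : ZM → ℝ) =ᵐ[volume] ψ})
    (hweak : ∀ (k : ℕ) (g : ZM → ℝ), IsTestFn g → IsGaugeInv g →
      ∫ x, u k x * hApply g x = physLevel (k + 1) * ∫ x, u k x * g x) :
    ∃ f : ℕ → ZM → ℝ, (∀ k (n : ℕ∞), ContDiff ℝ n (f k)) ∧ (∀ k, IsGaugeInv (f k)) ∧
      (∀ i j, ∫ x, f i x * f j x = if i = j then (1 : ℝ) else 0) ∧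
      (∀ k x, hApply (f k) x = physLevel (k + 1) * f k x) ∧ (∀ k, MemLp (f k) 2 volume) ∧
      (∀ k, (u k : ZM → ℝ) =ᵐ[volume] f k) := by
  choose f hf hfi hae hfE hf2 using
    fun k => exists_smooth_gaugeInv_classical_of_weak (hcl k) (hweak k)
  refine ⟨f, hf, hfi, fun i j => ?_, hfE, hf2, hae⟩
  have h1 : ⟪u i, u j⟫ = if i = j then (1 : ℝ) else 0 := orthonormal_iff_ite.1 hon i j
  rw [← h1, MeasureTheory.L2.inner_def]
  refine integral_congr_ae ?_
  filter_upwards [hae i, hae j] with x hi hj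
  rw [← hi, ← hj]
  simp only [RCLike.inner_apply, conj_trivial, mul_comm]

end Literature.Analysis.OperatorTheory.YMMatrixModel

end
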